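import Summits.AnomalousDissipation.AnomalousDissipation.Theses.TwoAndHalfD
import Literature.Analysis.FluidPDE.PeriodicBoundedMildTorus
import Literature.Analysis.FunctionSpaces.TorusClassicalNSGluing
import Summits.AnomalousDissipation.AnomalousDissipation.Theorems.TwoAndHalfDTwohalfdThesisStubWeakDuhamel

/-!
# T0 `stub_spinupShift`: the spin-up time of a released mixing witness is cosmetic

Registered tool stub of the line `Sketch` (duhamel-release) for the crux
`Summit.AnomalousDissipation.AnomalousDissipation.Theses.TwoAndHalfD.TwohalfdThesis`
(stmt-AnomalousDissipation-0206); the statement is registered verbatim on the item.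

CONTENT. The line's residual witness is a steadily forced classical planar Navier–Stokes solution
`(v, p)` on `[0, ∞) × 𝕋²` (viscosity `κ`, steady force `g`) together with, for every release time
`s ≥ 0`, a classical solution `φ s` of the unforced advection–diffusion equation
`∂ₜφ + v·∇φ = κΔφ` on `[s, ∞)` with `φ s s = h`; the witness's mixing clauses only hold after a
spin-up time `s₀ ≥ 0`. This file shows that the spin-up time can be normalised away: the
translates `t ↦ (v, p)(t + s₀)` and `t ↦ φ (s + s₀) (t + s₀)` form again an admissible family on
`[0, ∞)` with the same steady force and the same released pattern `h`.

PROOF. Both systems are autonomous and the force is steady. (1) Time translation of the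
Navier–Stokes solution (`Torus.IsClassicalNSSolutionOn.comp_add_const`) gives a solution on
`(· + s₀)⁻¹' [0, ∞) = [-s₀, ∞) ⊇ [0, ∞)`; restrict (`Torus.IsClassicalNSSolutionOn.mono`,
`uniqueDiffOn_Ici`). (2) For `s ≥ 0` the release at time `s + s₀ ≥ 0` translated by `s₀`
(`isClassicalScalarTransportOn_comp_add_const`) lives on `(· + s₀)⁻¹' [s + s₀, ∞) = [s, ∞)`
(`Set.preimage_add_const_Ici`), with drift `t ↦ v (t + s₀)`; its datum at `t = s` is
`φ (s + s₀) (s + s₀) = h`. Supports stmt-AnomalousDissipation-0206. [folklore]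
-/

noncomputable section

-- the summit path `AnomalousDissipation/AnomalousDissipation` duplicates a namespace component
set_option linter.dupNamespace false

namespace Summit.AnomalousDissipation.AnomalousDissipation.Theorems.TwohalfdThesis

open MeasureTheory Set Filter Topology
open scoped ENNReal NNReal InnerProductSpace
open Literature.Analysis.FunctionSpaces Literature.Analysis.FluidPDE

/-- **T0 `stub_spinupShift` (line `Sketch` = duhamel-release, crux `TwoAndHalfD.TwohalfdThesis`):
the spin-up time is cosmetic.** Let `(v, p)` be a classical solution of the planar Navier–Stokes
equations on `[0, ∞) × 𝕋²` with viscosity `κ` and the steady force `g`, and for every `s ≥ 0` let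
`φ s` be a classical solution of `∂ₜφ + v·∇φ = κΔφ` on `[s, ∞)` with `φ s s = h`. Then for every
`s₀ ≥ 0` the translates `t ↦ (v, p)(t + s₀)` solve the same steadily forced system on `[0, ∞)`,
and for every `s ≥ 0` the translate `t ↦ φ (s + s₀) (t + s₀)` is a classical solution of the
transport equation with drift `t ↦ v (t + s₀)` on `[s, ∞)` released from `h` at time `s`
(the equations are autonomous: `Torus.IsClassicalNSSolutionOn.comp_add_const` and `.mono`,
`isClassicalScalarTransportOn_comp_add_const`, `Set.preimage_add_const_Ici`). [folklore] -/
theorem stub_spinupShift : ∀ (κ s₀ : ℝ) (g : (UnitAddTorus (Fin 2)) → (EuclideanSpace ℝ (Fin 2))) (h : (UnitAddTorus (Fin 2)) → ℝ) (v : ℝ → (UnitAddTorus (Fin 2)) → (EuclideanSpace ℝ (Fin 2))) (p : ℝ → (UnitAddTorus (Fin 2)) → ℝ) (φ : ℝ → ℝ → (UnitAddTorus (Fin 2)) → ℝ), 0 ≤ s₀ → Torus.IsClassicalNSSolutionOn (Ici 0) κ (fun _ => g) v p → (∀ s, 0 ≤ s → Torus.IsClassicalScalarTransportOn (Ici s)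 κ v (φ s) ∧ φ s s = h) → Torus.IsClassicalNSSolutionOn (Ici 0) κ (fun _ => g) (fun t => v (t + s₀)) (fun t => p (t + s₀)) ∧ (∀ s, 0 ≤ s → Torus.IsClassicalScalarTransportOn (Ici s) κ (fun t => v (t + s₀)) (fun t => φ (s + s₀) (t + s₀)) ∧ φ (s + s₀) (s + s₀) = h) := by
  intro κ s₀ g h v p φ hs₀ hNS hφ
  refine ⟨?_, fun s hs => ⟨?_, (hφ (s + s₀) (add_nonneg hs hs₀)).2⟩⟩
  · -- (1) the Navier–Stokes solution: translate by `s₀`, then restrict `[-s₀, ∞)` to `[0, ∞)`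
    have h1 := hNS.comp_add_const s₀
    have hsub : Ici (0 : ℝ) ⊆ (· + s₀) ⁻¹' Ici 0 := fun t ht =>
      mem_preimage.2 (mem_Ici.2 (add_nonneg (mem_Ici.1 ht) hs₀))
    exact h1.mono hsub (uniqueDiffOn_Ici 0)
  · -- (2) the release at time `s + s₀`, translated by `s₀`, lives on `[s, ∞)`
    have h2 := isClassicalScalarTransportOn_comp_add_const (hφ (s + s₀) (add_nonneg hs hs₀)).1 s₀
    rw [Set.preimage_add_const_Ici, add_sub_cancel_right] at h2
    exact h2

end Summit.AnomalousDissipation.AnomalousDissipation.Theorems.TwohalfdThesis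

end
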